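import Mathlib
import Summits.FinalStateConjecture.FinalStateConjecture.Theorems.SoloInformedCombGenericity

/-!
# SoloInformed — the model set `c₀₀ ⊂ ℓ¹`: dense, meagre, escapable by lines; its comeagre
# complement is NOT escapable by lines or by analytic curves

Soloist `solo-FinalStateConjecture-informed`, session 20 (2026-08-19). First of three files
(`SoloInformedFinSupp`, `SoloInformedSlowWeights`, `SoloInformedCategoryBlind`) on the GENERICITY
QUANTIFIER of the summit `FinalStateConjecture` (`InitialDataSet.IsTameChristodoulouGeneric … 1`,
`Literature/Geometry/Lorentzian/TameGenericity.lean`: through every exceptional datum passes an injective,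
immersed, jointly smooth one-parameter family of admissible data meeting the exceptional set only at the
parameter `0`). No geometry is used; the model is the one of `SoloInformedCombGenericity.lean`
(`escapable 𝓓 E`: `C^∞` curves `γ : ℝ → V` in a real normed space with `deriv γ 0 ≠ 0`, injective,
`γ 0 = p`, values in `𝓓`, `γ c ∉ E` for `c ≠ 0`), run in the Banach space `V = ℓ¹(ℕ, ℝ)`
(`lp (fun _ ↦ ℝ) 1`) with the exceptional set `c₀₀ = finSupp` of finitely supported sequences.

This file: `c₀₀` is dense (`dense_finSupp`) and meagre (`isMeagre_finSupp`), so its complement is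
comeagre and dense (`dense_compl_finSupp`); `c₀₀` is escapable by straight lines
(`finSupp_subset_escapable`) and has Christodoulou's LINEAR codimension one
(`hasLinearCodimAtLeast_finSupp`, `Genericity.lean`); the complement `ℓ¹ ∖ c₀₀` does NOT have linear
codimension one in any admissible class (`not_hasLinearCodimAtLeast_compl_finSupp`: a line with two
parameters in `c₀₀` lies in `c₀₀`) and admits no REAL-ANALYTIC escaping curve (`not_analytic_escape`:
identity theorem coordinatewise + Baire on `ℝ`). The third file shows that it IS escapable by `C^∞`
curves. References: Christodoulou, CQG 16 (1999) A23, p. A24 [Christodoulou1999]; Oxtoby, *Measure and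
Category* (1980), Ch. 9.
-/

noncomputable section

set_option linter.dupNamespace false

open Set Filter Topology Literature.Geometry.Lorentzian
open scoped ContDiff ENNReal

namespace Summit.FinalStateConjecture.FinalStateConjecture.Theorems

/-! ### The model space `ℓ¹(ℕ, ℝ)` and the set `c₀₀` of finitely supported sequences -/

/-- The Banach space `ℓ¹(ℕ, ℝ)` of summable real sequences (Mathlib's `lp (fun _ ↦ ℝ) 1`). [folklore] -/
abbrev SeqL1 : Type := lp (fun _ : ℕ ↦ ℝ) 1

/-- The unit sequence `eₙ` (`1` at `n`, `0` elsewhere). [folklore] -/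
def unitSeq (n : ℕ) : SeqL1 := lp.single 1 n (1 : ℝ)

/-- The `n`-th coordinate of `eₙ` is `1`. [folklore] -/
theorem unitSeq_apply_self (n : ℕ) : unitSeq n n = 1 :=
  lp.single_apply_self (E := fun _ : ℕ ↦ ℝ) 1 n 1

/-- The other coordinates of `eₙ` vanish. [folklore] -/
theorem unitSeq_apply_ne {m n : ℕ} (h : m ≠ n) : unitSeq n m = 0 :=
  lp.single_apply_ne (E := fun _ : ℕ ↦ ℝ) 1 n 1 h

/-- `‖eₙ‖ = 1`. [folklore] -/
theorem norm_unitSeq (n : ℕ) : ‖unitSeq n‖ = 1 := by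
  rw [unitSeq, lp.norm_single one_pos]
  simp

/-- `a • eₙ` is the sequence with the single entry `a` at `n`. [folklore] -/
theorem smul_unitSeq (n : ℕ) (a : ℝ) : a • unitSeq n = lp.single 1 n a := by
  rw [unitSeq, ← lp.single_smul, smul_eq_mul, mul_one]

/-- Evaluation at a coordinate is continuous on `ℓ¹`. [folklore] -/
theorem continuous_apply_seq (n : ℕ) : Continuous fun f : SeqL1 ↦ f n :=
  (lp.lipschitzWith_one_eval (E := fun _ : ℕ ↦ ℝ) 1 n).continuous

/-- Evaluation at the coordinate `n` as a continuous linear functional on `ℓ¹`. [folklore] -/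
def evalSeq (n : ℕ) : SeqL1 →L[ℝ] ℝ := lp.evalCLM ℝ (fun _ : ℕ ↦ ℝ) 1 n

/-- `evalSeq n f = f n`. [folklore] -/
@[simp] theorem evalSeq_apply (n : ℕ) (f : SeqL1) : evalSeq n f = f n := rfl

/-- `c₀₀ ⊂ ℓ¹`: the finitely supported sequences. [folklore] -/
def finSupp : Set SeqL1 := {f | ∃ N : ℕ, ∀ n, N ≤ n → f n = 0}

/-- `c₀₀` as a linear subspace. [folklore] -/
def finSuppSub : Submodule ℝ SeqL1 where
  carrier := finSupp
  add_mem' := by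
    rintro f g ⟨N, hN⟩ ⟨M, hM⟩
    refine ⟨max N M, fun n hn ↦ ?_⟩
    rw [lp.coeFn_add, Pi.add_apply, hN n (le_of_max_le_left hn), hM n (le_of_max_le_right hn), add_zero]
  zero_mem' := ⟨0, fun n _ ↦ by rw [lp.coeFn_zero, Pi.zero_apply]⟩
  smul_mem' := by
    rintro c f ⟨N, hN⟩
    refine ⟨N, fun n hn ↦ ?_⟩
    rw [lp.coeFn_smul, Pi.smul_apply, hN n hn, smul_zero]

/-- Membership in the subspace `c₀₀`. [folklore] -/
@[simp] theorem mem_finSuppSub {f : SeqL1} : f ∈ finSuppSub ↔ f ∈ finSupp := Iff.rfl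

/-- Single-entry sequences are finitely supported. [folklore] -/
theorem single_mem_finSupp (n : ℕ) (a : ℝ) : lp.single 1 n a ∈ finSupp :=
  ⟨n + 1, fun m hm ↦ lp.single_apply_ne (E := fun _ : ℕ ↦ ℝ) 1 n a (show m ≠ n by omega)⟩

/-- `eₙ ∈ c₀₀`. [folklore] -/
theorem unitSeq_mem_finSupp (n : ℕ) : unitSeq n ∈ finSupp :=
  single_mem_finSupp n 1

/-! ### 1. `c₀₀` is dense and meagre; its complement is comeagre and dense -/

/-- `c₀₀` is dense in `ℓ¹` (the truncations `∑_{i<n} fᵢ eᵢ` converge to `f`). [folklore] -/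
theorem dense_finSupp : Dense finSupp := by
  intro f
  have h := (lp.hasSum_single (p := 1) ENNReal.one_ne_top f).tendsto_sum_nat
  refine mem_closure_of_tendsto h (Eventually.of_forall fun n ↦ ?_)
  exact finSuppSub.sum_mem fun i _ ↦ single_mem_finSupp i (f i)

/-- The closed subspace of sequences vanishing from the index `N` on. [folklore] -/
def vanishFrom (N : ℕ) : Set SeqL1 := {f | ∀ n, N ≤ n → f n = 0}

/-- `c₀₀ = ⋃_N {f | f vanishes from N on}`. [folklore] -/
theorem finSupp_eq_iUnion : finSupp = ⋃ N, vanishFrom N := by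
  ext f
  simp only [finSupp, vanishFrom, mem_setOf_eq, mem_iUnion]

/-- Each `vanishFrom N` is closed (coordinates are continuous). [folklore] -/
theorem isClosed_vanishFrom (N : ℕ) : IsClosed (vanishFrom N) := by
  have h : vanishFrom N = ⋂ n, ⋂ (_ : N ≤ n), (fun f : SeqL1 ↦ f n) ⁻¹' {0} := by
    ext f
    simp only [vanishFrom, mem_setOf_eq, mem_iInter, mem_preimage, mem_singleton_iff]
  rw [h]
  exact isClosed_iInter fun n ↦ isClosed_iInter fun _ ↦
    isClosed_singleton.preimage (continuous_apply_seq n)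

/-- Each `vanishFrom N` has empty interior (perturb the `N`-th coordinate). [folklore] -/
theorem interior_vanishFrom (N : ℕ) : interior (vanishFrom N) = ∅ := by
  refine eq_empty_iff_forall_notMem.mpr fun f hf ↦ ?_
  have hfN : f N = 0 := interior_subset hf N le_rfl
  obtain ⟨ε, hε, hball⟩ := Metric.mem_nhds_iff.mp (mem_interior_iff_mem_nhds.mp hf)
  have hg : f + lp.single 1 N (ε / 2) ∈ Metric.ball f ε := by
    rw [Metric.mem_ball, dist_eq_norm, add_sub_cancel_left, lp.norm_single one_pos, Real.norm_eq_abs,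
      abs_of_pos (half_pos hε)]
    exact half_lt_self hε
  have h0 := hball hg N le_rfl
  rw [lp.coeFn_add, Pi.add_apply, hfN, zero_add, lp.single_apply_self] at h0
  exact (half_pos hε).ne' h0

/-- `c₀₀` is meagre in `ℓ¹` (a countable union of closed sets with empty interior). [folklore] -/
theorem isMeagre_finSupp : IsMeagre finSupp := by
  rw [finSupp_eq_iUnion]
  exact isMeagre_iUnion fun N ↦
    ((isClosed_vanishFrom N).isNowhereDense_iff.mpr (interior_vanishFrom N)).isMeagre

/-- The complement `ℓ¹ ∖ c₀₀` is comeagre (by definition of `IsMeagre`) … [folklore] -/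
theorem compl_finSupp_mem_residual : finSuppᶜ ∈ residual SeqL1 :=
  isMeagre_finSupp

/-- … and dense (Baire). [folklore] -/
theorem dense_compl_finSupp : Dense finSuppᶜ :=
  dense_of_mem_residual compl_finSupp_mem_residual

/-! ### 2. `c₀₀` has comb codimension one (straight lines suffice) -/

/-- The geometric sequence `(2⁻ⁿ)ₙ ∈ ℓ¹`, a vector with no zero coordinate. [folklore] -/
def geomSeq : SeqL1 :=
  ⟨fun n ↦ ((1 : ℝ) / 2) ^ n, by
    refine memℓp_gen ?_
    have h : (fun n : ℕ ↦ ‖((1 : ℝ) / 2) ^ n‖ ^ (1 : ℝ≥0∞).toReal) = fun n ↦ ((1 : ℝ) / 2) ^ n := by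
      funext n
      rw [ENNReal.toReal_one, Real.rpow_one, norm_pow, Real.norm_eq_abs,
        abs_of_pos (by norm_num : (0 : ℝ) < 1 / 2)]
    rw [h]
    exact summable_geometric_of_lt_one (by norm_num) (by norm_num)⟩

/-- Coordinates of the geometric sequence. [folklore] -/
theorem geomSeq_apply (n : ℕ) : geomSeq n = ((1 : ℝ) / 2) ^ n := rfl

/-- The geometric sequence is not finitely supported. [folklore] -/
theorem geomSeq_notMem_finSupp : geomSeq ∉ finSupp := by
  rintro ⟨N, hN⟩
  have h := hN N le_rfl
  rw [geomSeq_apply] at h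
  exact (pow_pos (by norm_num : (0 : ℝ) < 1 / 2) N).ne' h

/-- The geometric sequence is non-zero. [folklore] -/
theorem geomSeq_ne_zero : geomSeq ≠ 0 := by
  intro h
  have h0 : geomSeq 0 = 0 := by rw [h, lp.coeFn_zero, Pi.zero_apply]
  rw [geomSeq_apply, pow_zero] at h0
  exact one_ne_zero h0

/-- If `f ∈ c₀₀` and `f + c • v ∈ c₀₀` with `c ≠ 0` then `v ∈ c₀₀`. [folklore] -/
theorem mem_finSupp_of_add_smul_mem {f v : SeqL1} {c : ℝ} (hf : f ∈ finSupp)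
    (h : f + c • v ∈ finSupp) (hc : c ≠ 0) : v ∈ finSupp := by
  have h1 : c • v ∈ finSupp := by
    have := finSuppSub.sub_mem h hf
    rwa [add_sub_cancel_left] at this
  have h2 := finSuppSub.smul_mem c⁻¹ h1
  rwa [inv_smul_smul₀ hc] at h2

/-- `c₀₀` has comb codimension one in the model of `SoloInformedCombGenericity`: through `f ∈ c₀₀` the
straight line `c ↦ f + c • (2⁻ⁿ)ₙ` escapes. [folklore] -/
theorem finSupp_subset_escapable : finSupp ⊆ escapable univ finSupp := by
  intro f hf
  have hd : HasDerivAt (fun c : ℝ ↦ f + c • geomSeq) ((1 : ℝ) • geomSeq) 0 :=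
    ((hasDerivAt_id (0 : ℝ)).smul_const geomSeq).const_add f
  refine ⟨fun c ↦ f + c • geomSeq, ?_, ?_, ?_, ?_, fun _ ↦ mem_univ _, ?_⟩
  · exact contDiff_const.add (contDiff_id.smul contDiff_const)
  · rw [hd.deriv, one_smul]
    exact geomSeq_ne_zero
  · simp
  · intro a b h
    exact smul_left_injective ℝ geomSeq_ne_zero (add_left_cancel h)
  · intro c hc hmem
    exact geomSeq_notMem_finSupp (mem_finSupp_of_add_smul_mem hf hmem hc)

/-- The same line witnesses Christodoulou's LINEAR codimension one (`HasLinearCodimAtLeast`,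
`Genericity.lean`) of `c₀₀`. [cite: Christodoulou1999, p. A24] -/
theorem hasLinearCodimAtLeast_finSupp : HasLinearCodimAtLeast (univ : Set SeqL1) finSupp 1 := by
  intro f hf
  refine ⟨fun _ ↦ geomSeq, ?_, fun _ ↦ mem_univ _, ?_⟩
  · exact linearIndependent_unique_iff.mpr geomSeq_ne_zero
  · intro c hc hmem
    rw [Fin.sum_univ_one] at hmem
    have hc0 : c 0 ≠ 0 := by
      intro h
      apply hc
      funext i
      rw [Subsingleton.elim i 0, h]
      rfl
    exact geomSeq_notMem_finSupp (mem_finSupp_of_add_smul_mem hf hmem hc0)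

/-! ### 5. Lines and analytic curves are not blind -/

/-- With STRAIGHT LINES the complement fails: `ℓ¹ ∖ c₀₀` does not have Christodoulou's linear
codimension one, whatever the admissible class (a line `d + c v` with two parameters in `c₀₀` lies in
`c₀₀`). [cite: Christodoulou1999, p. A24] -/
theorem not_hasLinearCodimAtLeast_compl_finSupp (𝓓 : Set SeqL1) :
    ¬ HasLinearCodimAtLeast 𝓓 finSuppᶜ 1 := by
  intro h
  obtain ⟨f, -, -, hf⟩ := h geomSeq geomSeq_notMem_finSupp
  have h1 : geomSeq + (1 : ℝ) • f 0 ∈ finSupp := by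
    have := hf (fun _ ↦ 1) (fun h0 ↦ one_ne_zero (congrFun h0 0))
    rwa [Fin.sum_univ_one, mem_compl_iff, not_not] at this
  have h2 : geomSeq + (2 : ℝ) • f 0 ∈ finSupp := by
    have := hf (fun _ ↦ 2) (fun h0 ↦ two_ne_zero (congrFun h0 0))
    rwa [Fin.sum_univ_one, mem_compl_iff, not_not] at this
  have h3 : f 0 ∈ finSupp := by
    have := finSuppSub.sub_mem h2 h1
    rwa [add_sub_add_left_eq_sub, ← sub_smul, show (2 : ℝ) - 1 = 1 by norm_num, one_smul] at this
  have h4 : geomSeq ∈ finSupp := by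
    have := finSuppSub.sub_mem h1 (finSuppSub.smul_mem (1 : ℝ) h3)
    rwa [add_sub_cancel_right] at this
  exact geomSeq_notMem_finSupp h4

/-- With REAL-ANALYTIC curves the complement fails too: no analytic curve through `d ∉ c₀₀` lies in
`c₀₀` for all `c ≠ 0`. For each coordinate `n` carrying a non-identically-zero (analytic) coordinate
function, its zero set is closed with empty interior (identity theorem); these countably many sets
would cover `ℝ ∖ {0}`, contradicting Baire. [folklore] -/
theorem not_analytic_escape {d : SeqL1} (hd : d ∉ finSupp) {γ : ℝ → SeqL1}
    (hγ : AnalyticOnNhd ℝ γ univ) (h0 : γ 0 = d) : ¬ ∀ c ≠ 0, γ c ∈ finSupp := by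
  intro h
  set I : Set ℕ := {n | ∃ c, γ c n ≠ 0} with hI
  have hcover : ({0}ᶜ : Set ℝ) ⊆ ⋃ n ∈ I, {c : ℝ | γ c n = 0} := by
    intro c hc
    rw [mem_compl_iff, mem_singleton_iff] at hc
    obtain ⟨N, hN⟩ := h c hc
    have hdN : ∃ n, N ≤ n ∧ d n ≠ 0 := by
      by_contra hne
      exact hd ⟨N, fun n hn ↦ by_contra fun hdn ↦ hne ⟨n, hn, hdn⟩⟩
    obtain ⟨n, hn, hdn⟩ := hdN
    refine mem_iUnion₂.mpr ⟨n, ⟨0, by rwa [h0]⟩, hN n hn⟩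
  have hmeagre : IsMeagre (⋃ n ∈ I, {c : ℝ | γ c n = 0}) := by
    refine isMeagre_biUnion (to_countable I) fun n hn ↦ ?_
    have hcont : Continuous fun c ↦ γ c n :=
      (continuous_apply_seq n).comp (continuousOn_univ.mp hγ.continuousOn)
    have hclosed : IsClosed {c : ℝ | γ c n = 0} := isClosed_singleton.preimage hcont
    refine (hclosed.isNowhereDense_iff.mpr ?_).isMeagre
    by_contra hne
    obtain ⟨c₀, hc₀⟩ := nonempty_iff_ne_empty.mpr hne
    have han : AnalyticOnNhd ℝ (fun c ↦ γ c n) univ := (evalSeq n).comp_analyticOnNhd hγ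
    have hev : (fun c ↦ γ c n) =ᶠ[𝓝 c₀] 0 :=
      (mem_of_superset (mem_interior_iff_mem_nhds.mp hc₀) fun c hc ↦ hc)
    have hzero := han.eqOn_zero_of_preconnected_of_eventuallyEq_zero isPreconnected_univ
      (mem_univ c₀) hev
    obtain ⟨c, hc⟩ := hn
    exact hc (hzero (mem_univ c))
  exact not_isMeagre_of_isOpen isOpen_compl_singleton ⟨1, by simp⟩ (hmeagre.mono hcover)

/-- In the vocabulary of `escapable`: no analytic escaping curve through a point of `ℓ¹ ∖ c₀₀`. [folklore] -/
theorem not_exists_analytic_escape {d : SeqL1} (hd : d ∈ finSuppᶜ) :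
    ¬ ∃ γ : ℝ → SeqL1, AnalyticOnNhd ℝ γ univ ∧ γ 0 = d ∧ ∀ c ≠ 0, γ c ∉ finSuppᶜ := by
  rintro ⟨γ, hγ, h0, h⟩
  exact not_analytic_escape hd hγ h0 fun c hc ↦ not_not.mp (h c hc)

end Summit.FinalStateConjecture.FinalStateConjecture.Theorems

end
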